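import Literature.MathematicalPhysics.KineticTheory.HarmonicChainCovariance
import Mathlib.Analysis.SpecificLimits.Basic
import Mathlib.Analysis.Real.Sqrt
import HarnessLib

/-!
# The flux of the harmonic chain in closed form (Nakazawa's solution) and its `N → ∞` limit

Trunk T-KINETIC (Literature/MathematicalPhysics/KineticTheory). Fifth decomposition step for the
named fact `Literature.Barriers.AtomisticToContinuum.HarmonicChainBallisticFlux` (provefact
unit): the EXPLICIT stationary covariance of the free-end pinned harmonic chain
`pinnedChain ω₂ 0 0 γ` between Langevin baths (the case treated by Nakazawa 1970, cf.
Bonetto–Lebowitz–Rey-Bellet 2000 §6.2 "pinned down everywhere"; Roy–Dhar 2008 eq. (2.8) "free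
ends, the N[akazawa] result"), PROVED, and from it the closed form of the flux coefficient
`fluxCoeff ω₂ γ N = c_N` of `HarmonicChainCovariance.lean` and its limit:

  `c_N = γ/(2(1+γ²)) · (r + r^{2N-2})/(1 + r^{2N-1}) ⟶ c_∞ = γ r/(2(1+γ²)) > 0`   (`N → ∞`),

where `0 < r < 1` is the root of `r² - (2+λ)r + 1 = 0`, `λ = ω₂γ²/(1+γ²)`, i.e.
`r = 1 + λ/2 - √(λ + λ²/4)`. With `m = k = 1`, `k_o = ω₂` this is Roy–Dhar's (2.8):
`J = γ k_B ΔT/(2(1+γ²)) [1 + λ/2 - (λ/2)√(1 + 4/λ)]` (their `λ = k_oγ²/(k(mk+γ²))`), since the mean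
current is `c_N (T_L - T_R)` (`chainCov_bond_eq_fluxCoeff`).

## The solution (antisymmetric part of the covariance, `T_L = 1`, `T_R = -1`)

With `u_k = r^k + r^{2N-1-k}` (two-sided solution of `u_{k+1} + u_{k-1} = (2+λ)u_k`, symmetric
under `k ↦ 2N-1-k`), `ζ_k = γ/(1+γ²) · u_k/u_0` and `h_m = (u_m - u_{m+1})/(ω₂ u_0)`:
`Z_{ij} = sgn(j-i) ζ_{|j-i|}` (Toeplitz, `⟨q_i p_j⟩`), `X_{ij} = h_{i+j}` (Hankel, `⟨q_i q_j⟩`),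
`Y = ω₂/(1+γ²) X + γ²/(1+γ²)(E_{00} - E_{N-1,N-1})` (`⟨p_i p_j⟩`), and `[[X, Z], [Zᵀ, Y]]` solves
`A S + S Aᵀ + Σ(1,-1) = 0`; by uniqueness (`eq_chainCov`) it IS `chainCov ω₂ γ N 1 (-1)`, whence
`2 c_N = ζ_1`. (This closed form was re-derived for this file and checked against exact rational
solutions of the Lyapunov equation for `N ≤ 9`; it agrees with Roy–Dhar (2.8) in the limit.)

## Contents

* `forceMatrix_mulVec_intFun` — `Φ` acting on a vector `k ↦ F(k)`, in indicator form.
* `OddProfile` (the four identities H1–H4 the profiles `ζ, h` must satisfy) and, under them,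
  `oddSol_lyapunov` — the block matrix solves the Lyapunov equation (entrywise verification).
* `rootR`, `useq`, `zetaSeq`, `hSeq` — the explicit profiles; `oddProfile_explicit`.
* `fluxCoeff_eq` — the closed form; `fluxLimit`, `fluxLimit_pos`, `tendsto_fluxCoeff`.

## References

* H. Nakazawa, *On the lattice thermal conduction*, Progr. Theoret. Phys. Suppl. 45 (1970)
  231–262 (free-end pinned chain; paywalled, not re-read: the formulas here are derived, and
  compared with the restatement (2.8) of Roy–Dhar). [cite: Nakazawa1970, free-end pinned-chain flux as restated in RoyDhar2008 eq. (2.8)]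
* D. Roy, A. Dhar, *Heat transport in ordered harmonic lattices*, J. Stat. Phys. 131 (2008)
  535–541 (arXiv:0711.4318), §2 eqs. (2.6)–(2.8). [cite: RoyDhar2008, §2 eqs. (2.6)-(2.8)]
* F. Bonetto, J. L. Lebowitz, L. Rey-Bellet (2000), §6.2. [cite: BonettoLebowitzReyBellet2000, §6.2]
-/

noncomputable section

open Matrix Filter Topology

namespace Literature.MathematicalPhysics.KineticTheory.HeatConduction

/-! ### The force matrix on vectors given by a function of the site index -/

section IntFun

variable {N : ℕ}

/-- Indicator of the left end: `[a = 0]`. [folklore] -/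
def indL (a : Fin N) : ℝ := if a.val = 0 then 1 else 0

/-- Indicator of the right end: `[a = N-1]`. [folklore] -/
def indR (a : Fin N) : ℝ := if a.val = N - 1 then 1 else 0

/-- `bathMult = [a=0] + [a=N-1]`. [folklore] -/
theorem bathMult_eq_indL_add_indR (a : Fin N) : (bathMult N a : ℝ) = indL a + indR a := rfl

/-- `bathTemp N 1 (-1) = [a=0] - [a=N-1]`. [folklore] -/
theorem bathTemp_one_neg_one (a : Fin N) : bathTemp N (1 : ℝ) (-1) a = indL a - indR a := by
  simp only [bathTemp, indL, indR]
  split_ifs <;> ring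

/-- `[a=0] = 1` at the left end. [folklore] -/
theorem indL_of_eq {a : Fin N} (h : a.val = 0) : indL a = 1 := if_pos h

/-- `[a=0] = 0` away from the left end. [folklore] -/
theorem indL_of_ne {a : Fin N} (h : a.val ≠ 0) : indL a = 0 := if_neg h

/-- `[a=N-1] = 1` at the right end. [folklore] -/
theorem indR_of_eq {a : Fin N} (h : a.val = N - 1) : indR a = 1 := if_pos h

/-- `[a=N-1] = 0` away from the right end. [folklore] -/
theorem indR_of_ne {a : Fin N} (h : a.val ≠ N - 1) : indR a = 0 := if_neg h

/-- **`Φ` on a profile.** If `v_k = F(k)` for a function `F : ℤ → ℝ` of the site index, then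
`(Φ v)_a = ω₂ F(a) + (1-[a=0])(F(a) - F(a-1)) - (1-[a=N-1])(F(a+1) - F(a))`. [folklore] -/
theorem forceMatrix_mulVec_intFun (ω₂ : ℝ) {v : Fin N → ℝ} {F : ℤ → ℝ}
    (hv : ∀ k : Fin N, v k = F k.val) (a : Fin N) :
    (forceMatrix ω₂ N *ᵥ v) a =
      ω₂ * F a.val + (1 - indL a) * (F a.val - F (a.val - 1)) -
        (1 - indR a) * (F (a.val + 1) - F a.val) := by
  rw [forceMatrix_mulVec_apply_eq]
  simp only [hv]
  have ha := a.isLt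
  by_cases h0 : a.val = 0 <;> by_cases hN : a.val = N - 1
  · rw [dif_neg (by omega), dif_neg (by omega), indL_of_eq h0, indR_of_eq hN]; ring
  · rw [dif_neg (by omega), dif_pos (by omega), indL_of_eq h0, indR_of_ne hN]
    push_cast; ring
  · rw [dif_pos (by omega), dif_neg (by omega), indL_of_ne h0, indR_of_eq hN]
    have e : (((⟨a.val - 1, by omega⟩ : Fin N).val : ℕ) : ℤ) = (a.val : ℤ) - 1 := by
      simp only; omega
    rw [e]; ring
  · rw [dif_pos (by omega), dif_pos (by omega), indL_of_ne h0, indR_of_ne hN]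
    have e : (((⟨a.val - 1, by omega⟩ : Fin N).val : ℕ) : ℤ) = (a.val : ℤ) - 1 := by
      simp only; omega
    rw [e]; push_cast; ring

end IntFun

/-! ### The abstract odd solution: profiles and the four identities -/

section OddSolution

variable (N : ℕ) (ω₂ γ : ℝ) (ζ hh : ℕ → ℝ)

/-- The antisymmetric Toeplitz profile `m ↦ sgn(m) ζ_{|m|}` on `ℤ`. [folklore] -/
def toepZ (m : ℤ) : ℝ := if 0 < m then ζ m.toNat else if m < 0 then -ζ (-m).toNat else 0

/-- `toepZ 0 = 0`. [folklore] -/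
theorem toepZ_zero : toepZ ζ 0 = 0 := by simp [toepZ]

/-- `toepZ k = ζ k` for a positive natural `k`. [folklore] -/
theorem toepZ_natCast {k : ℕ} (hk : 0 < k) : toepZ ζ (k : ℤ) = ζ k := by
  have h1 : (0 : ℤ) < (k : ℤ) := by omega
  rw [toepZ, if_pos h1, Int.toNat_natCast]

/-- `toepZ (-k) = -ζ k` for a positive natural `k`. [folklore] -/
theorem toepZ_neg_natCast {k : ℕ} (hk : 0 < k) : toepZ ζ (-(k : ℤ)) = -ζ k := by
  have h1 : ¬ (0 : ℤ) < -(k : ℤ) := by omega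
  have h2 : -(k : ℤ) < 0 := by omega
  rw [toepZ, if_neg h1, if_pos h2, neg_neg, Int.toNat_natCast]

/-- `toepZ` is odd. [folklore] -/
theorem toepZ_neg (m : ℤ) : toepZ ζ (-m) = -toepZ ζ m := by
  rcases lt_trichotomy m 0 with h | h | h
  · have h1 : 0 < -m := by omega
    have h2 : ¬ (0 < m) := by omega
    rw [toepZ, toepZ, if_pos h1, if_neg h2, if_pos h, neg_neg]
  · subst h; simp [toepZ]
  · have h1 : ¬ (0 < -m) := by omega
    have h2 : -m < 0 := by omega
    rw [toepZ, toepZ, if_neg h1, if_pos h2, if_pos h, neg_neg]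

/-- The position–momentum block `Z_{ij} = sgn(j-i) ζ_{|j-i|}` (`⟨q_i p_j⟩`). [folklore] -/
def oddZ : Matrix (Fin N) (Fin N) ℝ := Matrix.of fun i j => toepZ ζ ((j.val : ℤ) - i.val)

/-- The position–position block `X_{ij} = h_{i+j}` (Hankel; `⟨q_i q_j⟩`, antisymmetric part).
[folklore] -/
def oddX : Matrix (Fin N) (Fin N) ℝ := Matrix.of fun i j => hh (i.val + j.val)

/-- The momentum–momentum block `Y = ω₂/(1+γ²) X + γ²/(1+γ²) (E_{00} - E_{N-1,N-1})`. [folklore] -/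
def oddY : Matrix (Fin N) (Fin N) ℝ := Matrix.of fun i j =>
  ω₂ / (1 + γ ^ 2) * hh (i.val + j.val) + γ ^ 2 / (1 + γ ^ 2) * (indL i * indL j - indR i * indR j)

/-- Entries of `Z`. [folklore] -/
@[simp] theorem oddZ_apply (i j : Fin N) : oddZ N ζ i j = toepZ ζ ((j.val : ℤ) - i.val) := rfl

/-- Entries of `X`. [folklore] -/
@[simp] theorem oddX_apply (i j : Fin N) : oddX N hh i j = hh (i.val + j.val) := rfl

/-- Entries of `Y`. [folklore] -/
@[simp] theorem oddY_apply (i j : Fin N) : oddY N ω₂ γ hh i j =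
    ω₂ / (1 + γ ^ 2) * hh (i.val + j.val) + γ ^ 2 / (1 + γ ^ 2) * (indL i * indL j - indR i * indR j) :=
  rfl

/-- The candidate antisymmetric covariance `[[X, Z], [Zᵀ, Y]]` at temperatures `(1, -1)`.
[folklore] -/
def oddSol : Matrix (Fin N ⊕ Fin N) (Fin N ⊕ Fin N) ℝ :=
  Matrix.fromBlocks (oddX N hh) (oddZ N ζ) (oddZ N ζ)ᵀ (oddY N ω₂ γ hh)

/-- The four identities the profiles must satisfy (derived from the ansatz, see the module
docstring): (H1) `h_m - h_{m+1} = γ ζ_{m+1}`; (H2) `γ ω₂/(1+γ²) h_m = ζ_m - ζ_{m+1}`;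
(H3) `ζ_{2N-1-k} = ζ_k`; (H4) `ζ_0 = γ/(1+γ²)`. [folklore] -/
structure OddProfile : Prop where
  h1 : ∀ m : ℕ, hh m - hh (m + 1) = γ * ζ (m + 1)
  h2 : ∀ m : ℕ, γ * (ω₂ / (1 + γ ^ 2)) * hh m = ζ m - ζ (m + 1)
  h3 : ∀ k : ℕ, k ≤ 2 * N - 1 → ζ (2 * N - 1 - k) = ζ k
  h4 : ζ 0 = γ / (1 + γ ^ 2)

variable {N ω₂ γ ζ hh}

/-- (H2) in the form `(ω₂ - ω₂/(1+γ²)) h_m = γ(ζ_m - ζ_{m+1})`. [folklore] -/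
theorem OddProfile.h2' (P : OddProfile N ω₂ γ ζ hh) (m : ℕ) :
    (ω₂ - ω₂ / (1 + γ ^ 2)) * hh m = γ * (ζ m - ζ (m + 1)) := by
  rw [← P.h2 m]
  have hγ : (1 + γ ^ 2) ≠ 0 := by positivity
  field_simp
  ring

/-- `ζ_0 + γ · γ²/(1+γ²) = γ` under (H4). [folklore] -/
theorem OddProfile.h4' (P : OddProfile N ω₂ γ ζ hh) : ζ 0 + γ * (γ ^ 2 / (1 + γ ^ 2)) = γ := by
  rw [P.h4]
  have hγ : (1 + γ ^ 2) ≠ 0 := by positivity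
  field_simp

/-- `γ²/(1+γ²) = γ ζ_0` under (H4). [folklore] -/
theorem OddProfile.h4'' (P : OddProfile N ω₂ γ ζ hh) : γ ^ 2 / (1 + γ ^ 2) = γ * ζ 0 := by
  rw [P.h4]
  have hγ : (1 + γ ^ 2) ≠ 0 := by positivity
  field_simp

/-- `(Φ X_{i·})_j` in indicator form (rows of the Hankel block). [folklore] -/
theorem forceMatrix_mulVec_oddX_row (ω₂ : ℝ) (i j : Fin N) :
    (forceMatrix ω₂ N *ᵥ fun k => oddX N hh i k) j =
      ω₂ * hh (i.val + j.val) +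
        (1 - indL j) * (hh (i.val + j.val) - hh (i.val + (j.val - 1))) -
        (1 - indR j) * (hh (i.val + (j.val + 1)) - hh (i.val + j.val)) := by
  rw [forceMatrix_mulVec_intFun ω₂ (F := fun m : ℤ => hh (i.val + m.toNat))
    (fun k => by simp) j]
  have t1 : ((j.val : ℤ) + 1).toNat = j.val + 1 := by omega
  have t2 : ((j.val : ℤ) - 1).toNat = j.val - 1 := by omega
  simp only [Int.toNat_natCast, t1, t2]

/-- **Block (1,2) of the Lyapunov equation**: `Y = X Φ + Z Γ` entrywise, i.e.
`Y_{ij} = (Φ X_{i·})_j + γ([j=0]+[j=N-1]) Z_{ij}`. [folklore] -/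
theorem oddY_eq (P : OddProfile N ω₂ γ ζ hh) (i j : Fin N) :
    oddY N ω₂ γ hh i j =
      (forceMatrix ω₂ N *ᵥ fun k => oddX N hh i k) j + γ * bathMult N j * oddZ N ζ i j := by
  have hi := i.isLt
  have hj := j.isLt
  rw [forceMatrix_mulVec_oddX_row, bathMult_eq_indL_add_indR, oddY_apply, oddZ_apply]
  have e2 := P.h2' (i.val + j.val)
  have e1b := P.h1 (i.val + j.val)
  rw [show i.val + (j.val + 1) = i.val + j.val + 1 by ring]
  by_cases hj0 : j.val = 0 <;> by_cases hjN : j.val = N - 1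
  · -- `N = 1`
    have hi0 : i.val = 0 := by omega
    rw [indL_of_eq hj0, indR_of_eq hjN, indL_of_eq hi0, indR_of_eq (by omega : i.val = N - 1)]
    have hz : toepZ ζ ((j.val : ℤ) - i.val) = 0 := by
      rw [hj0, hi0, sub_self]; exact toepZ_zero ζ
    rw [hz]
    have e3 := P.h3 0 (by omega)
    rw [show 2 * N - 1 - 0 = i.val + j.val + 1 by omega, show (0 : ℕ) = i.val + j.val by omega]
      at e3
    rw [e3] at e2
    linear_combination -e2
  · -- `j = 0`, `N ≥ 2`
    rw [indL_of_eq hj0, indR_of_ne hjN]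
    by_cases hi0 : i.val = 0
    · rw [indL_of_eq hi0]
      have hz : toepZ ζ ((j.val : ℤ) - i.val) = 0 := by
        rw [hj0, hi0, sub_self]; exact toepZ_zero ζ
      rw [hz, P.h4'', show (0 : ℕ) = i.val + j.val by omega]
      linear_combination -e2 - e1b
    · rw [indL_of_ne hi0]
      have hz : toepZ ζ ((j.val : ℤ) - i.val) = -ζ (i.val + j.val) := by
        rw [show (j.val : ℤ) - i.val = -((i.val + j.val : ℕ) : ℤ) by omega]
        exact toepZ_neg_natCast ζ (by omega)
      rw [hz]
      linear_combination -e2 - e1b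
  · -- `j = N-1`, `N ≥ 2`
    rw [indL_of_ne hj0, indR_of_eq hjN]
    have e1a := P.h1 (i.val + (j.val - 1))
    rw [show i.val + (j.val - 1) + 1 = i.val + j.val by omega] at e1a
    by_cases hiN : i.val = N - 1
    · rw [indR_of_eq hiN]
      have hz : toepZ ζ ((j.val : ℤ) - i.val) = 0 := by
        rw [hjN, hiN, sub_self]; exact toepZ_zero ζ
      rw [hz]
      have e3 := P.h3 0 (by omega)
      rw [show 2 * N - 1 - 0 = i.val + j.val + 1 by omega] at e3
      rw [P.h4'', ← e3]
      linear_combination -e2 + e1a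
    · rw [indR_of_ne hiN]
      have hz : toepZ ζ ((j.val : ℤ) - i.val) = ζ (N - 1 - i.val) := by
        rw [show (j.val : ℤ) - i.val = ((N - 1 - i.val : ℕ) : ℤ) by omega]
        exact toepZ_natCast ζ (by omega)
      rw [hz]
      have e3 := P.h3 (N - 1 - i.val) (by omega)
      rw [show 2 * N - 1 - (N - 1 - i.val) = i.val + j.val + 1 by omega] at e3
      rw [← e3]
      linear_combination -e2 + e1a
  · -- `0 < j < N-1`
    rw [indL_of_ne hj0, indR_of_ne hjN]
    have e1a := P.h1 (i.val + (j.val - 1))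
    rw [show i.val + (j.val - 1) + 1 = i.val + j.val by omega] at e1a
    linear_combination -e2 + e1a - e1b

/-- `(Φ Z_{·j})_i` in indicator form (columns of the Toeplitz block). [folklore] -/
theorem forceMatrix_mulVec_oddZ_col (ω₂ : ℝ) (i j : Fin N) :
    (forceMatrix ω₂ N *ᵥ fun k => oddZ N ζ k j) i =
      ω₂ * toepZ ζ ((j.val : ℤ) - i.val) +
        (1 - indL i) * (toepZ ζ ((j.val : ℤ) - i.val) - toepZ ζ ((j.val : ℤ) - i.val + 1)) -
        (1 - indR i) * (toepZ ζ ((j.val : ℤ) - i.val - 1) - toepZ ζ ((j.val : ℤ) - i.val)) := by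
  rw [forceMatrix_mulVec_intFun ω₂ (v := fun k => oddZ N ζ k j)
    (F := fun m : ℤ => toepZ ζ ((j.val : ℤ) - m)) (fun k => rfl) i]
  have e1 : (j.val : ℤ) - ((i.val : ℤ) - 1) = (j.val : ℤ) - i.val + 1 := by ring
  have e2 : (j.val : ℤ) - ((i.val : ℤ) + 1) = (j.val : ℤ) - i.val - 1 := by ring
  simp only [e1, e2]

/-- **The commutator `ΦZ - ZΦ` on the border**: `(Φ Z_{·j})_i + (Φ Z_{·i})_j` in indicator form,
`= ζ(d)([j=0]+[j=N-1]-[i=0]-[i=N-1]) + ζ(d+1)([i=0]-[j=N-1]) + ζ(d-1)([i=N-1]-[j=0])`,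
`d = j - i`, `ζ(·) = toepZ`. [folklore] -/
theorem forceMatrix_oddZ_symm_sum (ω₂ : ℝ) (i j : Fin N) :
    (forceMatrix ω₂ N *ᵥ fun k => oddZ N ζ k j) i + (forceMatrix ω₂ N *ᵥ fun k => oddZ N ζ k i) j =
      toepZ ζ ((j.val : ℤ) - i.val) * (indL j + indR j - indL i - indR i) +
        toepZ ζ ((j.val : ℤ) - i.val + 1) * (indL i - indR j) +
        toepZ ζ ((j.val : ℤ) - i.val - 1) * (indR i - indL j) := by
  rw [forceMatrix_mulVec_oddZ_col, forceMatrix_mulVec_oddZ_col]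
  have o0 : toepZ ζ ((i.val : ℤ) - j.val) = -toepZ ζ ((j.val : ℤ) - i.val) := by
    rw [← toepZ_neg]; congr 1; ring
  have o1 : toepZ ζ ((i.val : ℤ) - j.val + 1) = -toepZ ζ ((j.val : ℤ) - i.val - 1) := by
    rw [← toepZ_neg]; congr 1; ring
  have o2 : toepZ ζ ((i.val : ℤ) - j.val - 1) = -toepZ ζ ((j.val : ℤ) - i.val + 1) := by
    rw [← toepZ_neg]; congr 1; ring
  rw [o0, o1, o2]
  ring

/-- **Block (2,2) of the Lyapunov equation**: `(ΦZ)_{ij} + (ΦZ)_{ji} + γ([i∈B]+[j∈B]) Y_{ij} = D_{ij}`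
with `D = diag(2γ([i=0] - [i=N-1]))` the noise at temperatures `(1,-1)`. [folklore] -/
theorem oddZ_oddY_eq (P : OddProfile N ω₂ γ ζ hh) (i j : Fin N) :
    (forceMatrix ω₂ N *ᵥ fun k => oddZ N ζ k j) i + (forceMatrix ω₂ N *ᵥ fun k => oddZ N ζ k i) j +
      γ * (bathMult N i + bathMult N j) * oddY N ω₂ γ hh i j =
      if i = j then 2 * γ * bathTemp N 1 (-1) i else 0 := by
  have hi := i.isLt
  have hj := j.isLt
  rw [forceMatrix_oddZ_symm_sum, bathMult_eq_indL_add_indR, bathMult_eq_indL_add_indR, oddY_apply,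
    bathTemp_one_neg_one]
  have e2 := P.h2 (i.val + j.val)
  have e4 := P.h4'
  by_cases hi0 : i.val = 0 <;> by_cases hiN : i.val = N - 1 <;>
    by_cases hj0 : j.val = 0 <;> by_cases hjN : j.val = N - 1
  all_goals (try (exfalso; omega))
  · -- N = 1, i = j = 0
    rw [indL_of_eq hi0, indR_of_eq hiN, indL_of_eq hj0, indR_of_eq hjN,
      if_pos (Fin.ext (by omega) : i = j)]
    have e3 := P.h3 0 (by omega)
    rw [show 2 * N - 1 - 0 = i.val + j.val + 1 by omega, show (0 : ℕ) = i.val + j.val by omega]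
      at e3
    rw [e3, sub_self] at e2
    linear_combination (4:ℝ) * e2
  · -- i = 0 (N ≥ 2), j = 0
    rw [indL_of_eq hi0, indR_of_ne hiN, indL_of_eq hj0, indR_of_ne hjN,
      if_pos (Fin.ext (by omega) : i = j)]
    have hz1 : toepZ ζ ((j.val : ℤ) - i.val + 1) = ζ 1 := by
      rw [hi0, hj0]; exact toepZ_natCast ζ one_pos
    have hz2 : toepZ ζ ((j.val : ℤ) - i.val - 1) = -ζ 1 := by
      rw [hi0, hj0]; exact toepZ_neg_natCast ζ one_pos
    rw [hz1, hz2]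
    rw [show i.val + j.val = 0 by omega] at e2 ⊢
    linear_combination (2:ℝ) * e2 + 2 * e4
  · -- i = 0, j = N-1 (N ≥ 2)
    rw [indL_of_eq hi0, indR_of_ne hiN, indL_of_ne hj0, indR_of_eq hjN,
      if_neg (fun h => by rw [h] at hi0; omega : i ≠ j)]
    have e3 := P.h3 (N - 1) (by omega)
    rw [show 2 * N - 1 - (N - 1) = i.val + j.val + 1 by omega, show N - 1 = i.val + j.val by omega]
      at e3
    linear_combination (2:ℝ) * e2 - 2 * e3
  · -- i = 0, j interior
    rw [indL_of_eq hi0, indR_of_ne hiN, indL_of_ne hj0, indR_of_ne hjN,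
      if_neg (fun h => by rw [h] at hi0; omega : i ≠ j)]
    have hz0 : toepZ ζ ((j.val : ℤ) - i.val) = ζ (i.val + j.val) := by
      rw [show (j.val : ℤ) - i.val = ((i.val + j.val : ℕ) : ℤ) by omega]
      exact toepZ_natCast ζ (by omega)
    have hz1 : toepZ ζ ((j.val : ℤ) - i.val + 1) = ζ (i.val + j.val + 1) := by
      rw [show (j.val : ℤ) - i.val + 1 = ((i.val + j.val + 1 : ℕ) : ℤ) by omega]
      exact toepZ_natCast ζ (by omega)
    rw [hz0, hz1]
    linear_combination e2
  · -- i = N-1 (N ≥ 2), j = 0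
    rw [indL_of_ne hi0, indR_of_eq hiN, indL_of_eq hj0, indR_of_ne hjN,
      if_neg (fun h => by rw [h] at hiN; omega : i ≠ j)]
    have e3 := P.h3 (N - 1) (by omega)
    rw [show 2 * N - 1 - (N - 1) = i.val + j.val + 1 by omega, show N - 1 = i.val + j.val by omega]
      at e3
    linear_combination (2:ℝ) * e2 - 2 * e3
  · -- i = N-1, j = N-1 (N ≥ 2)
    rw [indL_of_ne hi0, indR_of_eq hiN, indL_of_ne hj0, indR_of_eq hjN,
      if_pos (Fin.ext (by omega) : i = j)]
    have hz1 : toepZ ζ ((j.val : ℤ) - i.val + 1) = ζ 1 := by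
      rw [show (j.val : ℤ) - i.val + 1 = ((1 : ℕ) : ℤ) by omega]; exact toepZ_natCast ζ one_pos
    have hz2 : toepZ ζ ((j.val : ℤ) - i.val - 1) = -ζ 1 := by
      rw [show (j.val : ℤ) - i.val - 1 = -((1 : ℕ) : ℤ) by omega]
      exact toepZ_neg_natCast ζ one_pos
    rw [hz1, hz2]
    have e3a := P.h3 1 (by omega)
    have e3b := P.h3 0 (by omega)
    rw [show 2 * N - 1 - 1 = i.val + j.val by omega] at e3a
    rw [show 2 * N - 1 - 0 = i.val + j.val + 1 by omega] at e3b
    rw [e3a, e3b] at e2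
    linear_combination (2:ℝ) * e2 - 2 * e4
  · -- i = N-1, j interior
    rw [indL_of_ne hi0, indR_of_eq hiN, indL_of_ne hj0, indR_of_ne hjN,
      if_neg (fun h => by rw [h] at hiN; omega : i ≠ j)]
    have hz0 : toepZ ζ ((j.val : ℤ) - i.val) = -ζ (N - 1 - j.val) := by
      rw [show (j.val : ℤ) - i.val = -((N - 1 - j.val : ℕ) : ℤ) by omega]
      exact toepZ_neg_natCast ζ (by omega)
    have hz2 : toepZ ζ ((j.val : ℤ) - i.val - 1) = -ζ (N - j.val) := by
      rw [show (j.val : ℤ) - i.val - 1 = -((N - j.val : ℕ) : ℤ) by omega]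
      exact toepZ_neg_natCast ζ (by omega)
    rw [hz0, hz2]
    have e3a := P.h3 (N - j.val) (by omega)
    have e3b := P.h3 (N - 1 - j.val) (by omega)
    rw [show 2 * N - 1 - (N - j.val) = i.val + j.val by omega] at e3a
    rw [show 2 * N - 1 - (N - 1 - j.val) = i.val + j.val + 1 by omega] at e3b
    rw [e3a, e3b] at e2
    linear_combination e2
  · -- i interior, j = 0
    rw [indL_of_ne hi0, indR_of_ne hiN, indL_of_eq hj0, indR_of_ne hjN,
      if_neg (fun h => by rw [h] at hi0; exact hi0 hj0 : i ≠ j)]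
    have hz0 : toepZ ζ ((j.val : ℤ) - i.val) = -ζ (i.val + j.val) := by
      rw [show (j.val : ℤ) - i.val = -((i.val + j.val : ℕ) : ℤ) by omega]
      exact toepZ_neg_natCast ζ (by omega)
    have hz2 : toepZ ζ ((j.val : ℤ) - i.val - 1) = -ζ (i.val + j.val + 1) := by
      rw [show (j.val : ℤ) - i.val - 1 = -((i.val + j.val + 1 : ℕ) : ℤ) by omega]
      exact toepZ_neg_natCast ζ (by omega)
    rw [hz0, hz2]
    linear_combination e2
  · -- i interior, j = N-1
    rw [indL_of_ne hi0, indR_of_ne hiN, indL_of_ne hj0, indR_of_eq hjN,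
      if_neg (fun h => by rw [h] at hiN; exact hiN hjN : i ≠ j)]
    have hz0 : toepZ ζ ((j.val : ℤ) - i.val) = ζ (N - 1 - i.val) := by
      rw [show (j.val : ℤ) - i.val = ((N - 1 - i.val : ℕ) : ℤ) by omega]
      exact toepZ_natCast ζ (by omega)
    have hz1 : toepZ ζ ((j.val : ℤ) - i.val + 1) = ζ (N - i.val) := by
      rw [show (j.val : ℤ) - i.val + 1 = ((N - i.val : ℕ) : ℤ) by omega]
      exact toepZ_natCast ζ (by omega)
    rw [hz0, hz1]
    have e3a := P.h3 (N - i.val) (by omega)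
    have e3b := P.h3 (N - 1 - i.val) (by omega)
    rw [show 2 * N - 1 - (N - i.val) = i.val + j.val by omega] at e3a
    rw [show 2 * N - 1 - (N - 1 - i.val) = i.val + j.val + 1 by omega] at e3b
    rw [e3a, e3b] at e2
    linear_combination e2
  · -- both interior
    rw [indL_of_ne hi0, indR_of_ne hiN, indL_of_ne hj0, indR_of_ne hjN]
    split_ifs <;> ring

/-- `Z` is antisymmetric. [folklore] -/
theorem oddZ_antisymm (i j : Fin N) : oddZ N ζ j i = -oddZ N ζ i j := by
  rw [oddZ_apply, oddZ_apply, ← toepZ_neg]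
  congr 1
  ring

/-- `X` is symmetric. [folklore] -/
theorem oddX_symm (i j : Fin N) : oddX N hh j i = oddX N hh i j := by
  rw [oddX_apply, oddX_apply, add_comm]

/-- `Y` is symmetric. [folklore] -/
theorem oddY_symm (i j : Fin N) : oddY N ω₂ γ hh j i = oddY N ω₂ γ hh i j := by
  rw [oddY_apply, oddY_apply, add_comm j.val, mul_comm (indL j), mul_comm (indR j)]

/-- **The explicit matrix solves the Lyapunov equation at temperatures `(1, -1)`**:
`A S + S Aᵀ + Σ(1,-1) = 0` for `S = [[X, Z], [Zᵀ, Y]]`, block by block: (1,1) antisymmetry of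
`Z`; (1,2)/(2,1) `Y = XΦ + ZΓ`; (2,2) `ΦZ + (ΦZ)ᵀ + ΓY + YΓ = D`. [folklore] -/
theorem oddSol_lyapunov (P : OddProfile N ω₂ γ ζ hh) :
    driftMatrix ω₂ γ N * oddSol N ω₂ γ ζ hh + oddSol N ω₂ γ ζ hh * (driftMatrix ω₂ γ N)ᵀ +
      noiseMatrix γ N 1 (-1) = 0 := by
  ext a b
  rcases a with i | i <;> rcases b with j | j
  · rw [Matrix.add_apply, Matrix.add_apply, driftMatrix_mul_apply_inl,
      mul_driftMatrix_transpose_apply_inl]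
    simp only [oddSol, fromBlocks_apply₂₁, fromBlocks_apply₁₂, transpose_apply, noiseMatrix,
      fromBlocks_apply₁₁, Matrix.zero_apply, add_zero]
    rw [oddZ_antisymm]
    ring
  · rw [Matrix.add_apply, Matrix.add_apply, driftMatrix_mul_apply_inl,
      mul_driftMatrix_transpose_apply_inr]
    simp only [oddSol, fromBlocks_apply₂₂, fromBlocks_apply₁₁, fromBlocks_apply₁₂, noiseMatrix,
      Matrix.zero_apply, add_zero]
    rw [oddY_eq P i j]
    have e : ∑ k, oddX N hh i k * forceMatrix ω₂ N j k =
        (forceMatrix ω₂ N *ᵥ fun k => oddX N hh i k) j := by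
      simp only [mulVec, dotProduct]
      exact Finset.sum_congr rfl fun k _ => mul_comm _ _
    rw [e]
    ring
  · rw [Matrix.add_apply, Matrix.add_apply, driftMatrix_mul_apply_inr,
      mul_driftMatrix_transpose_apply_inl]
    simp only [oddSol, fromBlocks_apply₁₁, fromBlocks_apply₂₁, fromBlocks_apply₂₂, transpose_apply,
      noiseMatrix, Matrix.zero_apply, add_zero]
    rw [← oddY_symm, oddY_eq P j i]
    have e : ∑ k, forceMatrix ω₂ N i k * oddX N hh k j =
        (forceMatrix ω₂ N *ᵥ fun k => oddX N hh j k) i := by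
      simp only [mulVec, dotProduct]
      exact Finset.sum_congr rfl fun k _ => by rw [oddX_symm j k]
    rw [e]
    ring
  · rw [Matrix.add_apply, Matrix.add_apply, driftMatrix_mul_apply_inr,
      mul_driftMatrix_transpose_apply_inr]
    simp only [oddSol, fromBlocks_apply₁₂, fromBlocks_apply₂₂, fromBlocks_apply₂₁, transpose_apply,
      noiseMatrix, diagonal_apply, Matrix.zero_apply]
    have h := oddZ_oddY_eq P i j
    simp only [mulVec, dotProduct] at h
    have e : ∑ k, oddZ N ζ k i * forceMatrix ω₂ N j k = ∑ k, forceMatrix ω₂ N j k * oddZ N ζ k i :=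
      Finset.sum_congr rfl fun k _ => mul_comm _ _
    rw [e]
    split_ifs at h ⊢ <;> linear_combination -h

end OddSolution

/-! ### The explicit profiles -/

section Explicit

variable (ω₂ γ : ℝ)

/-- `λ = ω₂γ²/(1+γ²)` (Roy–Dhar's `λ = k_oγ²/(k(mk+γ²))` with `m = k = 1`, `k_o = ω₂`).
[cite: RoyDhar2008, §2 eq. (2.8)] -/
def lamb : ℝ := ω₂ * γ ^ 2 / (1 + γ ^ 2)

/-- The root `r = 1 + λ/2 - √(λ + λ²/4) ∈ (0,1)` of `r² - (2+λ)r + 1 = 0` (the decay rate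
`e^{-α}`, `cosh α = 1 + λ/2`, of the position–momentum covariances along the chain; Roy–Dhar's
bracket `[1 + λ/2 - (λ/2)√(1 + 4/λ)]`). [cite: RoyDhar2008, §2 eq. (2.8)] -/
def rootR : ℝ := 1 + lamb ω₂ γ / 2 - Real.sqrt (lamb ω₂ γ + (lamb ω₂ γ) ^ 2 / 4)

variable {ω₂ γ}

/-- `λ > 0`. [folklore] -/
theorem lamb_pos (hω : 0 < ω₂) (hγ : 0 < γ) : 0 < lamb ω₂ γ := by
  unfold lamb; positivity

/-- `r` solves `r² - (2+λ) r + 1 = 0`. [folklore] -/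
theorem rootR_quad (hω : 0 < ω₂) (hγ : 0 < γ) :
    rootR ω₂ γ ^ 2 - (2 + lamb ω₂ γ) * rootR ω₂ γ + 1 = 0 := by
  have hl := lamb_pos hω hγ
  set l := lamb ω₂ γ with hl'
  have hs : Real.sqrt (l + l ^ 2 / 4) ^ 2 = l + l ^ 2 / 4 := Real.sq_sqrt (by positivity)
  unfold rootR
  rw [← hl']
  nlinarith [hs]

/-- `0 < r`. [folklore] -/
theorem rootR_pos (hω : 0 < ω₂) (hγ : 0 < γ) : 0 < rootR ω₂ γ := by
  have hl := lamb_pos hω hγ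
  set l := lamb ω₂ γ with hl'
  unfold rootR
  rw [← hl', sub_pos, Real.sqrt_lt' (by positivity)]
  nlinarith

/-- `r < 1`. [folklore] -/
theorem rootR_lt_one (hω : 0 < ω₂) (hγ : 0 < γ) : rootR ω₂ γ < 1 := by
  have hl := lamb_pos hω hγ
  set l := lamb ω₂ γ with hl'
  unfold rootR
  rw [← hl']
  have : l / 2 < Real.sqrt (l + l ^ 2 / 4) := by
    rw [Real.lt_sqrt (by positivity)]
    nlinarith
  linarith

/-- `r + r⁻¹ = 2 + λ`. [folklore] -/
theorem rootR_add_inv (hω : 0 < ω₂) (hγ : 0 < γ) : rootR ω₂ γ + (rootR ω₂ γ)⁻¹ = 2 + lamb ω₂ γ := by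
  have hr := rootR_pos hω hγ
  have hq := rootR_quad hω hγ
  field_simp
  nlinarith [hq]

variable (ω₂ γ)

/-- The two-sided solution `u_k = r^k + r^{2N-1} r^{-k}` of `u_{k+1} + u_{k-1} = (2+λ) u_k` with
`u_{2N-1-k} = u_k` (Neumann condition `ζ_N = ζ_{N-1}` of the free end). [folklore] -/
def useq (N k : ℕ) : ℝ := rootR ω₂ γ ^ k + rootR ω₂ γ ^ (2 * N - 1) * (rootR ω₂ γ)⁻¹ ^ k

/-- The flux profile `ζ_k = γ/(1+γ²) · u_k/u_0` (`⟨q_i p_{i+k}⟩` at `(T_L,T_R) = (1,-1)`).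
[folklore] -/
def zetaSeq (N k : ℕ) : ℝ := γ / (1 + γ ^ 2) * (useq ω₂ γ N k / useq ω₂ γ N 0)

/-- The Hankel profile `h_m = (u_m - u_{m+1})/(ω₂ u_0)` (`⟨q_i q_j⟩ = h_{i+j}`). [folklore] -/
def hSeq (N m : ℕ) : ℝ := (useq ω₂ γ N m - useq ω₂ γ N (m + 1)) / (ω₂ * useq ω₂ γ N 0)

variable {ω₂ γ}

/-- `u_k > 0`. [folklore] -/
theorem useq_pos (hω : 0 < ω₂) (hγ : 0 < γ) (N k : ℕ) : 0 < useq ω₂ γ N k := by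
  have hr := rootR_pos hω hγ
  unfold useq; positivity

/-- The recurrence `u_{k+2} + u_k = (2+λ) u_{k+1}`. [folklore] -/
theorem useq_rec (hω : 0 < ω₂) (hγ : 0 < γ) (N k : ℕ) :
    useq ω₂ γ N (k + 2) + useq ω₂ γ N k = (2 + lamb ω₂ γ) * useq ω₂ γ N (k + 1) := by
  have hr := rootR_pos hω hγ
  have h := rootR_add_inv hω hγ
  set r := rootR ω₂ γ with hr'
  unfold useq
  rw [← h]
  have hrs : r * r⁻¹ = 1 := mul_inv_cancel₀ hr.ne'
  set s := r⁻¹ with hs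
  linear_combination (-(r ^ k + r ^ (2 * N - 1) * s ^ k)) * hrs

/-- The symmetry `u_{2N-1-k} = u_k` (`k ≤ 2N-1`). [folklore] -/
theorem useq_symm (hω : 0 < ω₂) (hγ : 0 < γ) (N : ℕ) {k : ℕ} (hk : k ≤ 2 * N - 1) :
    useq ω₂ γ N (2 * N - 1 - k) = useq ω₂ γ N k := by
  have hr := rootR_pos hω hγ
  set r := rootR ω₂ γ with hr'
  unfold useq
  rw [← hr']
  obtain ⟨m, hm⟩ : ∃ m, 2 * N - 1 = k + m := ⟨2 * N - 1 - k, by omega⟩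
  rw [hm, show k + m - k = m by omega, pow_add, inv_pow, inv_pow]
  field_simp
  ring

/-- **The explicit profiles satisfy (H1)–(H4).** [folklore] -/
theorem oddProfile_explicit (hω : 0 < ω₂) (hγ : 0 < γ) (N : ℕ) :
    OddProfile N ω₂ γ (zetaSeq ω₂ γ N) (hSeq ω₂ γ N) := by
  have hu0 : useq ω₂ γ N 0 ≠ 0 := (useq_pos hω hγ N 0).ne'
  have hγ2 : (1 + γ ^ 2) ≠ 0 := by positivity
  refine ⟨fun m => ?_, fun m => ?_, fun k hk => ?_, ?_⟩
  · have hrec := useq_rec hω hγ N m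
    have hω0 : ω₂ ≠ 0 := hω.ne'
    unfold hSeq zetaSeq
    rw [show m + 1 + 1 = m + 2 by ring, div_sub_div_same]
    have key : useq ω₂ γ N m - useq ω₂ γ N (m + 1) - (useq ω₂ γ N (m + 1) - useq ω₂ γ N (m + 2)) =
        lamb ω₂ γ * useq ω₂ γ N (m + 1) := by linear_combination hrec
    rw [key]
    unfold lamb
    field_simp
  · unfold hSeq zetaSeq
    field_simp
  · unfold zetaSeq
    rw [useq_symm hω hγ N hk]
  · unfold zetaSeq
    rw [div_self hu0, mul_one]

/-- **The antisymmetric covariance in closed form**: `chainCov ω₂ γ N 1 (-1)` equals the explicit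
block matrix (uniqueness of the Lyapunov solution). [folklore] -/
theorem chainCov_one_neg_one_eq (hω : 0 < ω₂) (hγ : 0 < γ) (N : ℕ) :
    chainCov ω₂ γ N 1 (-1) = oddSol N ω₂ γ (zetaSeq ω₂ γ N) (hSeq ω₂ γ N) :=
  (eq_chainCov hω hγ (oddSol_lyapunov (oddProfile_explicit hω hγ N))).symm

/-- **The flux coefficient in closed form (Nakazawa's free-end pinned chain):**
`c_N = γ/(2(1+γ²)) · (r + r^{2N-2})/(1 + r^{2N-1})` for `N ≥ 2`. [Roy–Dhar 2008, §2 eq. (2.8)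
(the `N → ∞` value); finite-`N` form derived here] [cite: RoyDhar2008, §2 eq. (2.8)] -/
theorem fluxCoeff_eq (hω : 0 < ω₂) (hγ : 0 < γ) {N : ℕ} (hN : 1 < N) :
    fluxCoeff ω₂ γ N = γ / (2 * (1 + γ ^ 2)) *
      ((rootR ω₂ γ + rootR ω₂ γ ^ (2 * N - 2)) / (1 + rootR ω₂ γ ^ (2 * N - 1))) := by
  have hr := rootR_pos hω hγ
  have h := chainCov_bond_eq_fluxCoeff hω hγ (N := N) 1 (-1) 0 (by omega)
  rw [chainCov_one_neg_one_eq hω hγ N] at h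
  simp only [oddSol, fromBlocks_apply₁₂, oddZ_apply] at h
  have hz : toepZ (zetaSeq ω₂ γ N) ((((⟨0 + 1, by omega⟩ : Fin N).val : ℕ) : ℤ) -
      ((⟨0, by omega⟩ : Fin N).val : ℕ)) = zetaSeq ω₂ γ N 1 := by
    simp only [Nat.zero_add, Nat.cast_one, Nat.cast_zero, sub_zero]
    exact_mod_cast toepZ_natCast (zetaSeq ω₂ γ N) one_pos
  rw [hz] at h
  have h2 : fluxCoeff ω₂ γ N = zetaSeq ω₂ γ N 1 / 2 := by linarith
  rw [h2]
  unfold zetaSeq useq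
  set r := rootR ω₂ γ with hr'
  have e : r ^ (2 * N - 1) * r⁻¹ ^ 1 = r ^ (2 * N - 2) := by
    rw [pow_one, show 2 * N - 1 = (2 * N - 2) + 1 by omega, pow_succ]
    field_simp
  rw [e]
  simp only [pow_zero, pow_one, mul_one]
  have hγ2 : (1 + γ ^ 2) ≠ 0 := by positivity
  have hden : (1 + r ^ (2 * N - 1)) ≠ 0 := by positivity
  field_simp

/-- **The limiting flux coefficient** `c_∞ = γ r/(2(1+γ²))` (Roy–Dhar (2.8) with `m = k = 1`,
`k_o = ω₂`: `J = γ k_B (T_L-T_R)/(2(1+γ²)) · [1 + λ/2 - (λ/2)√(1+4/λ)]`).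
[cite: RoyDhar2008, §2 eq. (2.8)] -/
def fluxLimit (ω₂ γ : ℝ) : ℝ := γ * rootR ω₂ γ / (2 * (1 + γ ^ 2))

/-- `c_∞ > 0`. [folklore] -/
theorem fluxLimit_pos (hω : 0 < ω₂) (hγ : 0 < γ) : 0 < fluxLimit ω₂ γ := by
  have hr := rootR_pos hω hγ
  unfold fluxLimit; positivity

/-- **Ballistic transport: `c_N → c_∞ > 0`** as `N → ∞` ("the heat current approaches a constant
value for large system sizes", Roy–Dhar 2008 §1 (ii); `r^{2N-2}, r^{2N-1} → 0` since `0 < r < 1`).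
[cite: RoyDhar2008, §2 eq. (2.8)] -/
theorem tendsto_fluxCoeff (hω : 0 < ω₂) (hγ : 0 < γ) :
    Tendsto (fun N => fluxCoeff ω₂ γ N) atTop (𝓝 (fluxLimit ω₂ γ)) := by
  have hr := rootR_pos hω hγ
  have hr1 := rootR_lt_one hω hγ
  set r := rootR ω₂ γ with hr'
  have hpow : Tendsto (fun n : ℕ => r ^ n) atTop (𝓝 0) :=
    tendsto_pow_atTop_nhds_zero_of_lt_one hr.le hr1
  have h1 : Tendsto (fun N : ℕ => r ^ (2 * N - 2)) atTop (𝓝 0) :=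
    hpow.comp (tendsto_atTop_atTop.mpr fun b => ⟨b + 2, fun n hn => by omega⟩)
  have h2 : Tendsto (fun N : ℕ => r ^ (2 * N - 1)) atTop (𝓝 0) :=
    hpow.comp (tendsto_atTop_atTop.mpr fun b => ⟨b + 1, fun n hn => by omega⟩)
  have h3 : Tendsto (fun N : ℕ => r + r ^ (2 * N - 2)) atTop (𝓝 r) := by
    simpa using tendsto_const_nhds.add h1
  have h4 : Tendsto (fun N : ℕ => 1 + r ^ (2 * N - 1)) atTop (𝓝 1) := by
    simpa using tendsto_const_nhds.add h2
  have h5 : Tendsto (fun N : ℕ => (r + r ^ (2 * N - 2)) / (1 + r ^ (2 * N - 1))) atTop (𝓝 r) := by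
    have := h3.div h4 one_ne_zero
    rw [div_one] at this
    exact this
  have h6 := h5.const_mul (γ / (2 * (1 + γ ^ 2)))
  have h7 : γ / (2 * (1 + γ ^ 2)) * r = fluxLimit ω₂ γ := by
    unfold fluxLimit; rw [← hr']; ring
  rw [← h7]
  refine h6.congr' ?_
  filter_upwards [eventually_gt_atTop 1] with N hN
  exact (fluxCoeff_eq hω hγ hN).symm

end Explicit

end Literature.MathematicalPhysics.KineticTheory.HeatConduction
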